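import Summits.ValiantsHypothesis.ValiantsHypothesis.Theorems.LacunarySymmetroidMatrixDescartesHalvingSweepRecursionArith

/-!
# Crux `MatrixDescartes` (stmt-ValiantsHypothesis-18050), line `halving-sweep-sesqui-law` —
# STUB 5 BY NAME: `stub_recursionArith : Stmt.stub_recursionArith` (by-name rule v2)

Line skeleton: ideator val-idea-2 (g0), `run/shared/lean/pub/ideators/val-idea-2/lines/line-halving-sweep-sesqui-law.lean`
r1 (sha16 `4a2515cbaafbeae4`; namespace `…Cruxes.MatrixDescartes.HalvingSweep`), crux idea
`Cruxes/MatrixDescartes/Ideas/halving-sweep-sesqui-law.md`.  The line is PUBLISHED, NOT registered on 18050 (line of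
record = `Lines/Lift.lean`), so this file is a `--supports stmt-ValiantsHypothesis-18050` HELPER.  By the cell's
by-name rule v2 it restates VERBATIM the two line-local statements the stub mentions — `HalvingRecursion` and
`SesquiLaw` (same bodies over the same tree predicates `PosRootLawAt`, `RealRootLawAt`; the Cruxes/ideator module
carries `sorry`s and is not an importable build target) — and the stub statement
`Stmt.stub_recursionArith := HalvingRecursion → SesquiLaw`, and proves `stub_recursionArith : Stmt.stub_recursionArith`
by the definition-free proof file `…HalvingSweepRecursionArith.lean` (`HalvingSweep.sesquiLaw_of_halvingRecursion`,
the same statement with the two `Prop`s unfolded).  The line file closes its `sorry` by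
`exact Summit.ValiantsHypothesis.ValiantsHypothesis.Theorems.LacunarySymmetroidMatrixDescartes.HalvingSweep.stub_recursionArith`
(checked: the line's `HalvingRecursion → SesquiLaw` and `Stmt.stub_recursionArith` below agree by `rfl`).

HONEST FRAMING: bookkeeping only (instrument tier, «arithmetic glue»).  `HalvingRecursion` and `SesquiLaw` are OPEN
statements of an ideator line, typed here as named `Prop`s and NEVER asserted; the only theorem is the implication
between them.  Nothing here bears on the line's load-bearing `GuardedWiggleLaw`, on `HalfSweepIneq`, on the crux
`LacunarySymmetroid.MatrixDescartes`, Conjecture B or the doors; rung currency 18050 open → open; `VP ≠ VNP` is NOT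
proved and nothing here is progress on it.
-/

-- `Summit.ValiantsHypothesis.ValiantsHypothesis.…` is the tree's mandated single-conjunct layout
-- (Sub = Summit), so the duplicated namespace component is intended.
set_option linter.dupNamespace false
set_option autoImplicit false

namespace Summit.ValiantsHypothesis.ValiantsHypothesis.Theorems.LacunarySymmetroidMatrixDescartes

open Summit.ValiantsHypothesis.ValiantsHypothesis.Theorems.MatrixDescartes.Negative (PosRootLawAt)
open scoped BigOperators

namespace HalvingSweep

/-- THE HALVING RECURSION in `PosRootLawAt` currency (window `K+1 ≥ c(log₂m+1)`) — VERBATIM copy of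
`Summit.ValiantsHypothesis.ValiantsHypothesis.Cruxes.MatrixDescartes.HalvingSweep.HalvingRecursion` of the line
skeleton `line-halving-sweep-sesqui-law.lean` r1 (by-name rule v2): there are `a c : ℕ` such that for all
`m K k B₁ B₂` with `c (⌊log₂ m⌋ + 1) ≤ K + 1`, `0 < k ≤ K`, the rows `ζ(m,k) ≤ B₁`, `ζ(m,K+1−k) ≤ B₂` give
`ζ(m,K+1) ≤ 2 (B₂ + m + 2 (a m (B₁ + B₂ + m) + ((K+1)(m+1))^a))`.  An OPEN statement of the line (it is the output
of the line's stubs 1–4), NEVER asserted here. -/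
def HalvingRecursion : Prop :=
  ∃ a c : ℕ, ∀ (m K k B₁ B₂ : ℕ), c * (Nat.log 2 m + 1) ≤ K + 1 → 0 < k → k ≤ K →
    PosRootLawAt m k B₁ → PosRootLawAt m (K + 1 - k) B₂ →
    PosRootLawAt m (K + 1) (2 * (B₂ + m + 2 * (a * m * (B₁ + B₂ + m) + ((K + 1) * (m + 1)) ^ a)))

/-- THE SESQUI LAW `ζ(m,K) ≤ 2^{C((log₂m+1)(log₂K+1) + (log₂m+1)²)}` (between Conjecture B and the refuted-on-paper
unguarded bilinear law) — VERBATIM copy of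
`Summit.ValiantsHypothesis.ValiantsHypothesis.Cruxes.MatrixDescartes.HalvingSweep.SesquiLaw` of the line skeleton
(by-name rule v2): some `C : ℕ` makes every format `(m, K)` satisfy the all-real-zeros row
`RealRootLawAt m K (2 ^ (C ((⌊log₂m⌋+1)(⌊log₂K⌋+1) + (⌊log₂m⌋+1)²)))`.  An OPEN law candidate of the line, NEVER
asserted here. -/
def SesquiLaw : Prop :=
  ∃ C : ℕ, ∀ m K : ℕ,
    RealRootLawAt m K (2 ^ (C * ((Nat.log 2 m + 1) * (Nat.log 2 K + 1) + (Nat.log 2 m + 1) ^ 2)))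

/-- STUB 5 of the line `halving-sweep-sesqui-law` (statement): `HalvingRecursion → SesquiLaw` — the by-name-rule-v2
name `Stmt.stub_recursionArith` of the line's `theorem stub_recursionArith : HalvingRecursion → SesquiLaw`.  Proved
below. -/
def Stmt.stub_recursionArith : Prop := HalvingRecursion → SesquiLaw

/-- **STUB 5 of the line `halving-sweep-sesqui-law`, PROVED BY NAME**: `stub_recursionArith : Stmt.stub_recursionArith`
(`= HalvingRecursion → SesquiLaw`), by the definition-free arithmetic proof
`HalvingSweep.sesquiLaw_of_halvingRecursion` (dyadic induction from the Descartes base + power-of-two envelope +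
reflection; constant `C = a(c+4) + 9a + c + 11`).  Arithmetic glue only. [folklore] -/
theorem stub_recursionArith : Stmt.stub_recursionArith := sesquiLaw_of_halvingRecursion

end HalvingSweep

end Summit.ValiantsHypothesis.ValiantsHypothesis.Theorems.LacunarySymmetroidMatrixDescartes
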